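/-
Copyright (c) 2026 the pub-hodgecm-mathlib formalisation cell (harness21).  Prover seat hodgecm-mathlib-K2E1-p10 (g5), Track B «K2-LIT», h413 = `stmt-HodgeConjecture-24833`,
R90-TF section S8 «ContSpec-n½», hCONT road C, step (C4) (S8 dealer R90-CS-plan (g3), S8-R182 (B) ∕ S8-R191 (3) ∕ S8-R193 «(C4) = first free»): the (R)′ road's letter `hCONT`
(★ p863731 `res_midBlock_le_residual_of_letters'''`, :293–:311) and the (V) road's rows (i′) `Fam hFd hFam` (★ p863385) FOR ONE GENERATOR, from the χ-exports WITH THE TRUNCATED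
FAMILY (★ (C2b) p863930, conjunct (E6)) at that generator's section, the χ POLE LEDGER placing the exports' poles inside `{1 < Re}` in a finite real set, and the uniqueness of the
continuation on the slit domain (★ `eqOn_reSlit_of_eqOn_re_gt`).
-/
import Summits.HodgeConjecture.HodgeConjecture.Theorems.R90S8ResGMidAtomArchStableU3    -- ★ p863205 (K2E1-p11): `eqOn_reSlit_of_eqOn_re_gt` (identity theorem on a slit half-plane); brings `eisensteinSeriesU`, `flatSectionU`, `truncation`, the S8 frame
import HarnessLib

/-!
# R90-TF · S8 «ContSpec-n½» — `R90S8ResGMidBlockHContOfExportsU3` ((C4)): hCONT FOR ONE GENERATOR FROM THE EXPORTS' TRUNCATED `L²`-FAMILY (E6), THE χ POLE LEDGER, AND UNIQUENESS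
# OF THE CONTINUATION — `∃ T ≥ 1, ∃ S finite real, ∃ Fam, DifferentiableOn ℂ Fam ({1<Re} ∖ (Sp ∪ S)) ∧ Fam z =ᵐ quotFun (Λ^T (Ec z))`

Cell `hodgecm-mathlib`, crux H413 (`stmt-HodgeConjecture-24833`, lane `--supports … --as helper`), route of record `HCCMUnconditional`; R90-TF section S8.  Deal S8-R182 (B) road C,
(C4) «first free of p10∕p16» (S8-R191 (3), S8-R193).  THEOREMS ONLY (no `def`, no `instance`, no notation, no named-fact hypothesis, no `sorry`; default heartbeats); count-neutral;
CLOSES NO SOCKET — it turns the letter `hCONT` of ★ p863731 ∕ the rows (i′) of ★ p863385 into «★ modulo {the exports OF RECORD consumed at the generator's section (★ (C2b)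
`chiEisenstein_meromorphic_exports_level_cm_three_with_truncatedFamily`, conjuncts `hEdiff` (holomorphy off `P`), (E1) `hE2`, (E6)), the χ POLE LEDGER «`P ∩ {1 < Re}` lies in a
finite real set» (K2E2-p12's `K2E1ChiEisensteinPoleLedgerCMThree`)}».

THE MATHEMATICS ([MoeglinWaldspurger1995, IV.1.9–IV.1.11, IV.2.3]; [BernsteinLapid2019, Thm 2.3, §4]; [Conway1978, IV §3]).  The letter `hCONT` binds an ARBITRARY continuation `Ec` of
the Eisenstein series of a section `φ` — holomorphic (per `g`) on the slit plane `{1 < Re} ∖ Sp`, `Sp` finite real, equal to `E(f_z^φ)` on the tube `{2 < Re}` — and asks for ONE level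
`T ≥ 1`, a finite real exceptional set `S` and an `L²(𝔛, μ)`-valued family `Fam`, holomorphic on `{1 < Re} ∖ (Sp ∪ S)`, representing `Λ^T(Ec z)` a.e.  The exports (★ (C2b)) produce
THEIR continuation `Ec′` with a closed pole set `P` and, by (E6), for every `T ≥ 1` a family `Fam` holomorphic on `Pᶜ` representing `Λ^T(Ec′ z)`; the ledger puts `P ∩ {1 < Re}` inside a
finite real `S`.  On `W := {1 < Re} ∖ (Sp ∪ S)` both `z ↦ Ec z g` and `z ↦ Ec′ z g` are holomorphic (`W ⊆ Pᶜ`) and they agree on `{2 < Re}` (both are the series), so they agree on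
`W` (★ `eqOn_reSlit_of_eqOn_re_gt`: a half-plane minus a finite real set); hence `Λ^T(Ec z) = Λ^T(Ec′ z)` for `z ∈ W` and the exports' `Fam` (at `T := 1`) answers `hCONT` with this
`S`.  No measure theory beyond the a.e. rewrite; no choice of `T` beyond `1`.
* §1 **`hCONT_of_truncatedFamily_exports`** — the per-generator `hCONT` conclusion (★ p863731's bytes after its binders) from the three named inputs; **`opRoadFamily_of_truncatedFamily_exports`**
  — the (V) road's rows (i′) shape on any open `D ⊆ {1 < Re} ∖ (Sp ∪ S)` (`Fam`, `hFd : DifferentiableOn ℂ Fam D`, `hFam` on `D`), same inputs, any `T ≥ 1`.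
HONEST LABEL: HC_CM is proved only modulo the 7 printed citations (2 remaining named inputs: hLiu418 = `stmt-HodgeConjecture-24832`, h413 = `stmt-HodgeConjecture-24833`) until rung 0
closes; this file asserts no named fact and closes no socket; (R)′ :337 and (V) :358 stay `sorry` in B ED. 7 until their OF-RECORD assemblies consume this head; count-neutral.

## References
* [MoeglinWaldspurger1995] C. Mœglin, J.-L. Waldspurger, *Spectral Decomposition and Eisenstein Series* (1995), IV.1.9–IV.1.11, IV.2.3.
* [BernsteinLapid2019] J. Bernstein, E. Lapid, *On the meromorphic continuation of Eisenstein series*, J. AMS 37 (2024), Thm 2.3, §4.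
* [Conway1978] J. B. Conway, *Functions of One Complex Variable* (1978), IV §3 (identity theorem).
-/

set_option autoImplicit false
set_option linter.dupNamespace false  -- the mandated namespace `…HodgeConjecture.HodgeConjecture.R90.S8` repeats the summit's segment

noncomputable section

open MeasureTheory Measure NumberField IsDedekindDomain Set Filter Topology
open scoped ENNReal NNReal
open Literature.NumberTheory.Automorphic Literature.NumberTheory.Automorphic.UnitaryGroup AdelicGroupData
open Summit.HodgeConjecture.HodgeConjecture.Cruxes.H413.K2E1BorelEisensteinU

namespace Summit.HodgeConjecture.HodgeConjecture.R90.S8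

variable (L : Type) [Field L] [NumberField L] [IsCMField L]
  [MeasurableSpace (quasiSplit (↥(maximalRealSubfield L)) L (IsCMField.complexConj L) 3).Adelic]

/-- **(C4) `hCONT` FOR ONE GENERATOR, FROM THE EXPORTS' TRUNCATED FAMILY, THE POLE LEDGER AND UNIQUENESS.**  Data: the generator's section `φ`, its continuation `Ec` with a finite real
`Sp`, holomorphic (per `g`) on `{1 < Re} ∖ Sp` (`hEd`) and equal to the series on the tube (`hE2`) — the `hCONT` frame of ★ p863731; the exports' continuation `Ec′` with pole set `P`:
holomorphy off `P` (`hEdiff′`), the tube identity (`hE2′`) and (E6) (`hE6′`, ★ (C2b) `…_with_truncatedFamily`, last conjunct); the ledger's finite real `S` with `P ∩ {1 < Re} ⊆ S`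
(`hS`, `hPS`).  THEN `∃ T ≥ 1, ∃ S finite real, ∃ Fam : ℂ → L²(μ), DifferentiableOn ℂ Fam ({1<Re} ∖ (Sp ∪ S)) ∧ ∀ z there, Fam z =ᵐ[μ] quotFun (Λ^T (Ec z))` — ★ p863731's `hCONT`
conclusion BYTE FOR BYTE (`T := 1`, the ledger's `S`, the exports' family; `Ec = Ec′` on `{1<Re} ∖ (Sp ∪ S)` by ★ `eqOn_reSlit_of_eqOn_re_gt`).
[cite: MoeglinWaldspurger1995, IV.1.11, IV.2.3] [cite: BernsteinLapid2019, Thm 2.3, §4] [cite: Conway1978, IV §3] -/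
theorem hCONT_of_truncatedFamily_exports
    (μ : Measure (quasiSplit (↥(maximalRealSubfield L)) L (IsCMField.complexConj L) 3).automorphicQuotient)
    {φ : (quasiSplit (↥(maximalRealSubfield L)) L (IsCMField.complexConj L) 3).Adelic → ℂ}
    (Ec : ℂ → (quasiSplit (↥(maximalRealSubfield L)) L (IsCMField.complexConj L) 3).Adelic → ℂ) (Sp : Finset ℂ) (hSp : ∀ s ∈ Sp, s.im = 0 ∧ 1 < s.re ∧ s.re ≤ 2)
    (hEd : ∀ g, DifferentiableOn ℂ (fun z => Ec z g) ({z : ℂ | 1 < z.re} \ (↑Sp : Set ℂ)))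
    (hE2 : ∀ z : ℂ, 2 < z.re → Ec z = eisensteinSeriesU (flatSectionU φ z))
    (ν : Measure ↥(adelicUnipotent (↥(maximalRealSubfield L)) L (IsCMField.complexConj L) 3)) (𝓕 : Set ↥(adelicUnipotent (↥(maximalRealSubfield L)) L (IsCMField.complexConj L) 3))
    -- the exports' continuation `Ec′` with pole set `P`: holomorphy off `P`, (E1), (E6) (★ (C2b))
    {Ec' : ℂ → (quasiSplit (↥(maximalRealSubfield L)) L (IsCMField.complexConj L) 3).Adelic → ℂ} {P : Set ℂ}
    (hEdiff' : ∀ g, DifferentiableOn ℂ (fun z => Ec' z g) Pᶜ) (hE2' : ∀ z : ℂ, 2 < z.re → Ec' z = eisensteinSeriesU (flatSectionU φ z))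
    (hE6' : ∀ T : ℝ≥0, 1 ≤ T → ∃ Fam : ℂ → Lp ℂ 2 μ, DifferentiableOn ℂ Fam Pᶜ ∧
      ∀ z : ℂ, z ∉ P → ((Fam z : Lp ℂ 2 μ) : (quasiSplit (↥(maximalRealSubfield L)) L (IsCMField.complexConj L) 3).automorphicQuotient → ℂ) =ᵐ[μ]
        (quasiSplit (↥(maximalRealSubfield L)) L (IsCMField.complexConj L) 3).quotFun (truncation ν 𝓕 T (Ec' z)))
    -- the χ POLE LEDGER: the exports' poles in `{1 < Re}` lie in a finite real set `S`
    {S : Finset ℂ} (hS : ∀ s ∈ S, s.im = 0) (hPS : P ∩ {z : ℂ | 1 < z.re} ⊆ (↑S : Set ℂ)) :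
    ∃ (T : ℝ≥0) (_ : 1 ≤ T) (S : Finset ℂ) (_ : ∀ s ∈ S, s.im = 0) (Fam : ℂ → (quasiSplit (↥(maximalRealSubfield L)) L (IsCMField.complexConj L) 3).L2 μ),
      DifferentiableOn ℂ Fam ({z : ℂ | 1 < z.re} \ (↑(Sp ∪ S) : Set ℂ)) ∧
      ∀ z ∈ ({z : ℂ | 1 < z.re} \ (↑(Sp ∪ S) : Set ℂ)), ((Fam z : (quasiSplit (↥(maximalRealSubfield L)) L (IsCMField.complexConj L) 3).L2 μ) : (quasiSplit (↥(maximalRealSubfield L)) L (IsCMField.complexConj L) 3).automorphicQuotient → ℂ) =ᵐ[μ] (quasiSplit (↥(maximalRealSubfield L)) L (IsCMField.complexConj L) 3).quotFun (truncation ν 𝓕 T (Ec z)) := by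
  classical
  -- the slit domain `W := {1 < Re} ∖ (Sp ∪ S)` lies off the pole set
  have hWP : ({z : ℂ | 1 < z.re} \ (↑(Sp ∪ S) : Set ℂ)) ⊆ Pᶜ := by
    intro z hz hzP
    have hzS : z ∈ (↑S : Set ℂ) := hPS ⟨hzP, hz.1⟩
    exact hz.2 (by rw [Finset.coe_union]; exact Or.inr hzS)
  -- `Ec = Ec′` on `W` (identity theorem on the slit half-plane: both holomorphic on `W`, equal on the tube)
  have hreal : ∀ s ∈ (↑(Sp ∪ S) : Set ℂ), s.im = 0 := by
    intro s hs
    rw [Finset.coe_union] at hs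
    rcases hs with hs | hs
    · exact (hSp s hs).1
    · exact hS s hs
  have hclosed : IsClosed (↑(Sp ∪ S) : Set ℂ) := (Sp ∪ S).finite_toSet.isClosed
  have hEq : ∀ g, EqOn (fun z => Ec z g) (fun z => Ec' z g) ({z : ℂ | 1 < z.re} \ (↑(Sp ∪ S) : Set ℂ)) := fun g =>
    eqOn_reSlit_of_eqOn_re_gt (a := 1) (b := 2) hreal hclosed
      ((hEd g).mono fun z hz => ⟨hz.1, fun hzSp => hz.2 (by rw [Finset.coe_union]; exact Or.inl hzSp)⟩)
      ((hEdiff' g).mono hWP) fun z hz => by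
        show Ec z g = Ec' z g
        rw [hE2 z hz, hE2' z hz]
  -- the exports' family at `T := 1`
  obtain ⟨Fam, hFd, hFam⟩ := hE6' 1 le_rfl
  refine ⟨1, le_rfl, S, hS, Fam, hFd.mono hWP, fun z hz => ?_⟩
  have hfun : Ec z = Ec' z := funext fun g => hEq g hz
  rw [hfun]
  exact hFam z (hWP hz)

/-- **THE (V) ROAD's ROWS (i′) FROM THE SAME INPUTS, ANY LEVEL `T ≥ 1`, ANY OPEN `D` INSIDE THE SLIT DOMAIN**: with the data of `hCONT_of_truncatedFamily_exports` and `T ≥ 1`, for every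
`D ⊆ {1 < Re} ∖ (Sp ∪ S)` there is `Fam : ℂ → L²(μ)` with `DifferentiableOn ℂ Fam D` and `Fam z =ᵐ[μ] quotFun (Λ^T (Ec z))` on `D` — the `(Fam, hFd, hFam)` binders of ★ p863385
`resGMidBlock_ne_bot_assembly` (rows (i′), at its punctured-neighbourhood domain `D` once `D` avoids the ledger's `S`). [cite: MoeglinWaldspurger1995, IV.1.11, IV.2.3] [cite: BernsteinLapid2019, Thm 2.3, §4] -/
theorem opRoadFamily_of_truncatedFamily_exports
    (μ : Measure (quasiSplit (↥(maximalRealSubfield L)) L (IsCMField.complexConj L) 3).automorphicQuotient)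
    {φ : (quasiSplit (↥(maximalRealSubfield L)) L (IsCMField.complexConj L) 3).Adelic → ℂ}
    (Ec : ℂ → (quasiSplit (↥(maximalRealSubfield L)) L (IsCMField.complexConj L) 3).Adelic → ℂ) (Sp : Finset ℂ) (hSp : ∀ s ∈ Sp, s.im = 0 ∧ 1 < s.re ∧ s.re ≤ 2)
    (hEd : ∀ g, DifferentiableOn ℂ (fun z => Ec z g) ({z : ℂ | 1 < z.re} \ (↑Sp : Set ℂ)))
    (hE2 : ∀ z : ℂ, 2 < z.re → Ec z = eisensteinSeriesU (flatSectionU φ z))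
    (ν : Measure ↥(adelicUnipotent (↥(maximalRealSubfield L)) L (IsCMField.complexConj L) 3)) (𝓕 : Set ↥(adelicUnipotent (↥(maximalRealSubfield L)) L (IsCMField.complexConj L) 3))
    {Ec' : ℂ → (quasiSplit (↥(maximalRealSubfield L)) L (IsCMField.complexConj L) 3).Adelic → ℂ} {P : Set ℂ}
    (hEdiff' : ∀ g, DifferentiableOn ℂ (fun z => Ec' z g) Pᶜ) (hE2' : ∀ z : ℂ, 2 < z.re → Ec' z = eisensteinSeriesU (flatSectionU φ z))
    (hE6' : ∀ T : ℝ≥0, 1 ≤ T → ∃ Fam : ℂ → Lp ℂ 2 μ, DifferentiableOn ℂ Fam Pᶜ ∧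
      ∀ z : ℂ, z ∉ P → ((Fam z : Lp ℂ 2 μ) : (quasiSplit (↥(maximalRealSubfield L)) L (IsCMField.complexConj L) 3).automorphicQuotient → ℂ) =ᵐ[μ]
        (quasiSplit (↥(maximalRealSubfield L)) L (IsCMField.complexConj L) 3).quotFun (truncation ν 𝓕 T (Ec' z)))
    {S : Finset ℂ} (hS : ∀ s ∈ S, s.im = 0) (hPS : P ∩ {z : ℂ | 1 < z.re} ⊆ (↑S : Set ℂ))
    {T : ℝ≥0} (hT : 1 ≤ T) {D : Set ℂ} (hD : D ⊆ {z : ℂ | 1 < z.re} \ (↑(Sp ∪ S) : Set ℂ)) :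
    ∃ Fam : ℂ → (quasiSplit (↥(maximalRealSubfield L)) L (IsCMField.complexConj L) 3).L2 μ, DifferentiableOn ℂ Fam D ∧
      ∀ z ∈ D, ((Fam z : (quasiSplit (↥(maximalRealSubfield L)) L (IsCMField.complexConj L) 3).L2 μ) : (quasiSplit (↥(maximalRealSubfield L)) L (IsCMField.complexConj L) 3).automorphicQuotient → ℂ) =ᵐ[μ]
        (quasiSplit (↥(maximalRealSubfield L)) L (IsCMField.complexConj L) 3).quotFun (truncation ν 𝓕 T (Ec z)) := by
  classical
  have hWP : ({z : ℂ | 1 < z.re} \ (↑(Sp ∪ S) : Set ℂ)) ⊆ Pᶜ := by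
    intro z hz hzP
    have hzS : z ∈ (↑S : Set ℂ) := hPS ⟨hzP, hz.1⟩
    exact hz.2 (by rw [Finset.coe_union]; exact Or.inr hzS)
  have hreal : ∀ s ∈ (↑(Sp ∪ S) : Set ℂ), s.im = 0 := by
    intro s hs
    rw [Finset.coe_union] at hs
    rcases hs with hs | hs
    · exact (hSp s hs).1
    · exact hS s hs
  have hclosed : IsClosed (↑(Sp ∪ S) : Set ℂ) := (Sp ∪ S).finite_toSet.isClosed
  have hEq : ∀ g, EqOn (fun z => Ec z g) (fun z => Ec' z g) ({z : ℂ | 1 < z.re} \ (↑(Sp ∪ S) : Set ℂ)) := fun g =>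
    eqOn_reSlit_of_eqOn_re_gt (a := 1) (b := 2) hreal hclosed
      ((hEd g).mono fun z hz => ⟨hz.1, fun hzSp => hz.2 (by rw [Finset.coe_union]; exact Or.inl hzSp)⟩)
      ((hEdiff' g).mono hWP) fun z hz => by
        show Ec z g = Ec' z g
        rw [hE2 z hz, hE2' z hz]
  obtain ⟨Fam, hFd, hFam⟩ := hE6' T hT
  refine ⟨Fam, hFd.mono (hD.trans hWP), fun z hz => ?_⟩
  have hfun : Ec z = Ec' z := funext fun g => hEq g (hD hz)
  rw [hfun]
  exact hFam z (hWP (hD hz))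

end Summit.HodgeConjecture.HodgeConjecture.R90.S8

end
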